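import Literature.Probability.Percolation.QuadCrossingNullFrontier

/-!
# Line `registered`, stub 3: domination transfer to the shrunk rectangle (`stub_strictlyDominated_shrink`)

Crux `Summit.CriticalPhenomena.CardyFormulaZ2.Theses.CardyBondTriangular.DiscretisationBridge`
(stmt-CriticalPhenomena-0787), line `registered`, stub `stub_strictlyDominated_shrink`: if a quad
`Q'` of the plane is strictly dominated by the square `Q₀ = Quad.rectQuad H 1 1` (`[-1, 1]²` read
through a plane homeomorphism `H`), then `Q'` is strictly dominated by the shorter-and-taller
rectangle `Quad.rectQuad H (1 - s) (1 + s)` for some `s ∈ (0, 1/2]`.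

Proof: Schramm–Smirnov's `<` is an open condition — the upper section `{P : Q' < P}` is open
(`Quad.isOpen_setOf_strictlyDominated_right`), hence contains a ball around `Q₀` in the uniform
metric of `𝒬_ℂ`; and `Quad.exists_rect_near` puts `Quad.rectQuad H (1 - s) (1 + s)` inside that
ball for all small `s` (uniform continuity of `H` near the square).

References: O. Schramm, S. Smirnov, Ann. Probab. 39 (2011) 1768–1814, §1.3 and proof of
Lemma 5.1.
-/

noncomputable section

open Set Filter Metric
open scoped Topology unitInterval
open Literature.Probability.Percolation Literature.Probability.Percolation.QuadCrossing

namespace Summit.CriticalPhenomena.CardyFormulaZ2.Cruxes.DiscretisationBridge.Birth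

/-- **Stub 3 of line `registered` (domination transfer, easier side).** If `Q' < Q₀ = rectQuad H 1 1`
strictly in Schramm–Smirnov's order on the quads of the plane, then `Q' < rectQuad H (1-s) (1+s)`
strictly for some `s ∈ (0, 1/2]`: strict domination is an open condition
(`Quad.isOpen_setOf_strictlyDominated_right`) and the shrunk rectangles tend to `Q₀` uniformly
(`Quad.exists_rect_near`). [cite: SchrammSmirnov2011, §1.3 and proof of Lemma 5.1] -/
theorem stub_strictlyDominated_shrink :
    ∀ (H : ℂ ≃ₜ ℂ) (Q' : Literature.Probability.Percolation.QuadCrossing.Quad (Set.univ : Set ℂ)),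
      Literature.Probability.Percolation.QuadCrossing.Quad.StrictlyDominated Q'
          (Literature.Probability.Percolation.QuadCrossing.Quad.rectQuad H 1 1 one_pos one_pos
            (fun _ => Set.mem_univ _)) →
        ∃ (s : ℝ) (hs : 0 < s) (hs1 : s < 1), s ≤ 1 / 2 ∧
          Literature.Probability.Percolation.QuadCrossing.Quad.StrictlyDominated Q'
            (Literature.Probability.Percolation.QuadCrossing.Quad.rectQuad H (1 - s) (1 + s)
              (sub_pos.2 hs1) (add_pos one_pos hs) (fun _ => Set.mem_univ _)) := by
  intro H Q' h
  -- the upper section `{P : Q' < P}` is open and contains `Q₀`: take a ball around `Q₀` inside it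
  obtain ⟨ε, hε, hball⟩ := Metric.isOpen_iff.1 (Quad.isOpen_setOf_strictlyDominated_right Q')
    (Quad.rectQuad H 1 1 one_pos one_pos (fun _ => Set.mem_univ _)) h
  -- room for the perturbations: rectangles within `τ` of the square are `ε/2`-close to `Q₀`
  obtain ⟨τ, hτ, hτ2, hroom⟩ := Quad.exists_rect_near isOpen_univ
    (Quad.rectQuad H 1 1 one_pos one_pos (fun _ => Set.mem_univ _)) H (fun p => rfl) (half_pos hε)
  have hτ1 : τ < 1 := hτ2.trans_lt (by norm_num)
  refine ⟨τ, hτ, hτ1, hτ2, ?_⟩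
  have h1 : |1 - τ - 1| ≤ τ := by
    rw [show (1 : ℝ) - τ - 1 = -τ by ring, abs_neg, abs_of_pos hτ]
  have h2 : |1 + τ - 1| ≤ τ := by
    rw [show (1 : ℝ) + τ - 1 = τ by ring, abs_of_pos hτ]
  have hpt := (hroom (1 - τ) (1 + τ) h1 h2).2
  refine hball (mem_ball.2 ?_)
  calc dist (Quad.rectQuad H (1 - τ) (1 + τ) (sub_pos.2 hτ1) (add_pos one_pos hτ)
          (fun _ => Set.mem_univ _))
        (Quad.rectQuad H 1 1 one_pos one_pos (fun _ => Set.mem_univ _)) ≤ ε / 2 := by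
        rw [Quad.dist_eq, ContinuousMap.dist_le_iff_of_nonempty]
        exact fun p => (hpt p).le
    _ < ε := half_lt_self hε

end Summit.CriticalPhenomena.CardyFormulaZ2.Cruxes.DiscretisationBridge.Birth

end
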